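import Summits.CriticalPhenomena.SAWScalingLimit.Theorems.SAWLoopFugacityFlowAvoidanceLimitDeterminantalMatrix
import Summits.CriticalPhenomena.SAWScalingLimit.Theorems.SAWLoopFugacityFlowAvoidanceLimitDeterminantalLoopGas

/-!
# `det(1 - xA)` is the loop(`-2`) + dimer(`-1`) dressed SAW — stub `stub_determinantal` of line
`symplectic-fermion-anchor` (crux `SAWLoopFugacityFlow.AvoidanceLimit`, stmt-CriticalPhenomena-10649)

On every finite piece `(H, Λ)` of `ℤ²` (`H ≤ zdGraph 2`, `Λ` finite), at loop fugacity `n = -2` and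
dimer fugacity `t = -1` the line's dressed self-avoiding walk `dimerPF n t x H Λ A` (Defs file
`…AvoidanceLimitAnchorDefs`) is a determinant:
`Z(H, Λ; {a} ∆ {b}) = adj(1 - xA)_{ab}` and `Z(H, Λ; ∅) = det(1 - xA)`, `A` the adjacency matrix of
`H|_Λ` (`stub_determinantal`, the registered signature of skeleton
`Cruxes/AvoidanceLimit/Lines/symplectic-fermion-anchor.lean`, consumed by `Rδ_anchor_eq_greenRatio`).
Proof: strong induction on `|Λ|` (`dimerPF_anchor_eq_adjugate_and_det`). The two-source function
satisfies the first-step recursion of the adjugate (`dimerPF_two_eq` here — the dimers ride along —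
against `adjugate_kmat_eq` of `…DeterminantalMatrix`), the source-free one the row expansion of the
determinant (`dimerPF_empty_eq`: the dimer `{v,u}` of fugacity `-x²` cancels the one-edge open
strand `{v,u}` of the loop-gas recursion `pfun_empty_eq`, leaving `Z(Λ;∅) = Z(Λ∖v;∅) - xΣ_{u∼v}
Z(Λ;{v}∆{u})`, against `det_kmat_eq`). Permutation reading: a `k`-cycle along edges weighs `-x^k`
in each orientation (`n = -2`), a transposition `-x²` (`t = -1`). Checked in exact arithmetic on
small grids by the ideator and two triagers (item evidence). Sources: G. Lawler, Probab. Surveys 15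
(2018) Prop. 3.1 [Lawler2018]; B. Nienhuis, Phys. Rev. Lett. 49 (1982) [Nienhuis1982]. No
definitions; the stub statement is the only non-helper declaration.
-/

noncomputable section

open scoped BigOperators Topology symmDiff
open Filter Finset
open Literature.Probability.RandomPlanarGeometry Literature.Probability.LatticeModels

namespace Summit.CriticalPhenomena.SAWScalingLimit.Theorems.AvoidanceLimit.Anchor

namespace DetExpansion

-- Local notations only (NO auxiliary definitions): indicator `[u ∼ v]`, `K_Λ = 1 - xA`, degree,
-- collision-free configurations, weight `x^{|F|}(-2)^{loops}`, `Z_{⟨-2,0,x⟩}` — whichever occur below.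
local notation "aind[" H ", " u ", " v "]" =>
  (@ite ℝ (SimpleGraph.Adj H u v) (Classical.propDecidable _) (1 : ℝ) 0)
local notation "K[" H ", " Λ ", " x "]" => ((1 : Matrix Λ Λ ℝ) - x • adjMat H Λ)
local notation "deg[" F ", " z "]" => Finset.card (Finset.filter (fun e => z ∈ e) F)
local notation "cfC[" H ", " S ", " A "]" =>
  Finset.filter (fun F => DiluteLoopModel.oscVerts S F = ∅) (DiluteLoopModel.configs H S A)
local notation "pf[" H ", " x ", " S ", " A "]" =>
  DiluteLoopModel.partitionFunction (⟨-2, 0, x⟩ : DiluteLoopModel ℝ) H S A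

/-! ## The dimer layer: one-vertex recursions of `Z_{-2,-1,x}` -/

section Dimers

open DiluteLoopModel SimpleGraph

variable {H : SimpleGraph (Site 2)} [H.LocallyFinite]

/-- **First-step recursion of the two-source dressed SAW at `(-2, -1)`**: for `a ≠ b` in `Λ`,
`Z(Λ; {a}∆{b}) = x Σ_{u ∼ a, u ≠ b} Z(Λ∖a; {u}∆{b}) + x [a ∼ b] Z(Λ∖{a,b}; ∅)`. [folklore] -/
theorem dimerPF_two_eq (hH : H ≤ zdGraph 2) (x : ℝ) {Λ : Finset (Site 2)} {a b : Site 2} (ha : a ∈ Λ)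
    (hb : b ∈ Λ) (hab : a ≠ b) :
    dimerPF (-2 : ℝ) (-1) x H Λ ({a} ∆ {b}) = x * ∑ u ∈ Λ.erase a, aind[H, a, u] *
      (if u = b then dimerPF (-2 : ℝ) (-1) x H ((Λ.erase a).erase b) ∅
        else dimerPF (-2 : ℝ) (-1) x H (Λ.erase a) ({u} ∆ {b})) := by
  have hdC : dimerConfigs H Λ ({a} ∆ {b}) = dimerConfigs H ((Λ.erase a).erase b) ∅ := by
    rw [dimerConfigs_eq_sdiff, sdiff_symmDiff_eq hab]
  -- Step 1: the loop-gas recursion inside each dimer term, then exchange the sums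
  have h1 : dimerPF (-2 : ℝ) (-1) x H Λ ({a} ∆ {b}) = x * ∑ u ∈ Λ.erase a, aind[H, a, u] *
      ∑ M ∈ (dimerConfigs H Λ ({a} ∆ {b})).filter (fun M => u ∉ covered Λ M), (-1 * x ^ 2) ^ #M *
        (if u = b then pf[H, x, ((Λ \ covered Λ M).erase a).erase b, ∅]
          else pf[H, x, (Λ \ covered Λ M).erase a, {u} ∆ {b}]) := by
    rw [dimerPF_anchor_eq]
    have inner : ∀ M ∈ dimerConfigs H Λ ({a} ∆ {b}),
        (-1 * x ^ 2) ^ #M * pf[H, x, Λ \ covered Λ M, {a} ∆ {b}] =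
        ∑ u ∈ (Λ \ covered Λ M).erase a, x * ((-1 * x ^ 2) ^ #M * (aind[H, a, u] *
          (if u = b then pf[H, x, ((Λ \ covered Λ M).erase a).erase b, ∅]
            else pf[H, x, (Λ \ covered Λ M).erase a, {u} ∆ {b}]))) := by
      intro M hM
      have haA : a ∈ ({a} ∆ {b} : Finset (Site 2)) := by simp [mem_symmDiff, hab]
      have haM : a ∈ Λ \ covered Λ M := Finset.mem_sdiff.2 ⟨ha, fun h =>
        let ⟨_, e, he, hae⟩ := mem_covered.1 h
        (mem_dimerConfigs.1 hM).2.2 a haA e he hae⟩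
      rw [pfun_two_eq hH x haM hab, mul_sum, mul_sum]
      refine sum_congr rfl fun u _ => ?_
      ring
    rw [sum_congr rfl inner, sum_comm' (t' := Λ.erase a)
      (s' := fun u => (dimerConfigs H Λ ({a} ∆ {b})).filter (fun M => u ∉ covered Λ M))]
    · rw [mul_sum]
      refine sum_congr rfl fun u _ => ?_
      rw [mul_sum, mul_sum]
      refine sum_congr rfl fun M _ => ?_
      ring
    · intro M u
      rw [Finset.mem_filter, mem_erase, mem_erase, Finset.mem_sdiff]
      tauto
  rw [h1]
  congr 1
  refine sum_congr rfl fun u hu => ?_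
  congr 1
  by_cases hub : u = b
  · subst hub
    simp only [if_true]
    rw [dimerPF_anchor_eq, hdC, Finset.filter_true_of_mem]
    · refine sum_congr rfl fun M hM => ?_
      rw [sdiff_erase_comm, sdiff_erase_comm, covered_eq_of_subset (mem_dimerConfigs.1 hM).1
        ((erase_subset _ _).trans (erase_subset _ _))]
    · intro M hM h
      obtain ⟨_, e, he, hue⟩ := mem_covered.1 h
      exact (mem_erase.1 ((mem_edgesIn_iff.1 ((mem_dimerConfigs.1 hM).1 he)).2 u hue)).1 rfl
  · simp only [hub, if_false]
    have hu' : u ∈ (Λ.erase a).erase b := mem_erase.2 ⟨hub, hu⟩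
    have hset : ((Λ.erase a).erase b).erase u = Λ.erase a \ ({u} ∆ {b}) := by
      rw [sdiff_symmDiff_eq hub]
      ext z; simp only [mem_erase]; tauto
    rw [dimerPF_anchor_eq, hdC, Finset.filter_congr (q := fun M => u ∉ covered ((Λ.erase a).erase b) M)
      (fun M hM => by rw [covered_eq_of_subset (mem_dimerConfigs.1 hM).1
        ((erase_subset _ _).trans (erase_subset _ _))]), filter_notMem_covered, hset,
      ← dimerConfigs_eq_sdiff]
    refine sum_congr rfl fun M hM => ?_
    rw [dimerConfigs_eq_sdiff, ← hset] at hM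
    have hMsub : M ⊆ edgesIn H (Λ.erase a) := (mem_dimerConfigs.1 hM).1.trans fun e he => by
      have h' := mem_edgesIn_iff.1 he
      exact mem_edgesIn_iff.2 ⟨h'.1, fun z hz => mem_of_mem_erase (mem_of_mem_erase (h'.2 z hz))⟩
    rw [sdiff_erase_comm, covered_eq_of_subset hMsub (erase_subset _ _)]

/-- Removing the dimer at `v`: a dimer configuration of `Λ ∖ {v, u}`. [folklore] -/
theorem erase_mem_dimerConfigs {Λ : Finset (Site 2)} {v u : Site 2} {M : Finset (Sym2 (Site 2))}
    (hM : M ∈ dimerConfigs H Λ ∅) (he : s(v, u) ∈ M) :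
    M.erase s(v, u) ∈ dimerConfigs H ((Λ.erase v).erase u) ∅ := by
  obtain ⟨hsub, hdeg, -⟩ := mem_dimerConfigs.1 hM
  have heΛ := mem_edgesIn_iff.1 (hsub he)
  have hv : v ∈ Λ := heΛ.2 v (Sym2.mem_mk_left _ _)
  have hu : u ∈ Λ := heΛ.2 u (Sym2.mem_mk_right _ _)
  refine mem_dimerConfigs.2 ⟨fun e' he' => ?_, fun z hz => (deg_mono (erase_subset _ _) z).trans
    (hdeg z (mem_of_mem_erase (mem_of_mem_erase hz))), fun z hz => absurd hz (notMem_empty z)⟩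
  obtain ⟨hne, he'⟩ := mem_erase.1 he'
  have h' := mem_edgesIn_iff.1 (hsub he')
  refine mem_edgesIn_iff.2 ⟨h'.1, fun z hz =>
    mem_erase.2 ⟨fun hzu => hne ?_, mem_erase.2 ⟨fun hzv => hne ?_, h'.2 z hz⟩⟩⟩
  · exact eq_of_deg_le_one (hdeg u hu) he' (hzu ▸ hz) he (Sym2.mem_mk_right _ _)
  · exact eq_of_deg_le_one (hdeg v hv) he' (hzv ▸ hz) he (Sym2.mem_mk_left _ _)

/-- Adding the dimer `{v, u}` to a dimer configuration of `Λ ∖ {v, u}`. [folklore] -/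
theorem insert_mem_dimerConfigs {Λ : Finset (Site 2)} {v u : Site 2} {M' : Finset (Sym2 (Site 2))}
    (hM' : M' ∈ dimerConfigs H ((Λ.erase v).erase u) ∅) (hvu : H.Adj v u) (hv : v ∈ Λ) (hu : u ∈ Λ) :
    insert s(v, u) M' ∈ dimerConfigs H Λ ∅ ∧ s(v, u) ∉ M' := by
  obtain ⟨hsub, hdeg, -⟩ := mem_dimerConfigs.1 hM'
  have hout : ∀ z, z = v ∨ z = u → ∀ e ∈ M', z ∉ e := by
    rintro z hz e he hze
    have h := (mem_edgesIn_iff.1 (hsub he)).2 z hze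
    rcases hz with rfl | rfl
    · exact (mem_erase.1 (mem_erase.1 h).2).1 rfl
    · exact (mem_erase.1 h).1 rfl
  have he : s(v, u) ∉ M' := fun h => hout v (Or.inl rfl) _ h (Sym2.mem_mk_left _ _)
  refine ⟨mem_dimerConfigs.2 ⟨fun e' he' => ?_, fun z hz => ?_, fun z hz => absurd hz (notMem_empty z)⟩, he⟩
  · rw [mem_insert] at he'
    rcases he' with rfl | he'
    · refine mem_edgesIn_iff.2 ⟨(mem_edgeSet H).2 hvu, fun z hz => ?_⟩
      rcases Sym2.mem_iff.1 hz with rfl | rfl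
      · exact hv
      · exact hu
    · have h' := mem_edgesIn_iff.1 (hsub he')
      exact mem_edgesIn_iff.2 ⟨h'.1, fun z hz => mem_of_mem_erase (mem_of_mem_erase (h'.2 z hz))⟩
  · rw [deg_insert he]
    by_cases hze : z ∈ s(v, u)
    · rw [if_pos hze, deg_eq_zero_iff.2 (hout z (Sym2.mem_iff.1 hze))]
    · rw [if_neg hze, add_zero]
      by_cases hz' : z ∈ (Λ.erase v).erase u
      · exact hdeg z hz'
      · rw [deg_eq_zero_iff.2 fun e he hze' => hz' ((mem_edgesIn_iff.1 (hsub he)).2 z hze')]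
        exact zero_le_one

/-- **The dimer at `v`**: `Σ_{M ∋ {v,u}} c^{|M|} Z(Λ∖V(M); ∅) = c · Z_{-2,-1}(Λ∖{v,u}; ∅)`. [folklore] -/
theorem sum_filter_dimer (x : ℝ) {Λ : Finset (Site 2)} {v u : Site 2} (hvu : H.Adj v u)
    (hv : v ∈ Λ) (hu : u ∈ Λ) :
    ∑ M ∈ (dimerConfigs H Λ ∅).filter (fun M => s(v, u) ∈ M),
        (-1 * x ^ 2) ^ #M * pf[H, x, Λ \ covered Λ M, ∅] =
      (-1 * x ^ 2) * dimerPF (-2 : ℝ) (-1) x H ((Λ.erase v).erase u) ∅ := by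
  rw [dimerPF_anchor_eq, mul_sum]
  refine sum_nbij' (fun M => M.erase s(v, u)) (fun M' => insert s(v, u) M')
    (fun M hM => erase_mem_dimerConfigs (Finset.mem_filter.1 hM).1 (Finset.mem_filter.1 hM).2)
    (fun M' hM' => ?_) (fun M hM => insert_erase (Finset.mem_filter.1 hM).2)
    (fun M' hM' => erase_insert (insert_mem_dimerConfigs hM' hvu hv hu).2) (fun M hM => ?_)
  · have h := insert_mem_dimerConfigs hM' hvu hv hu
    exact Finset.mem_filter.2 ⟨h.1, mem_insert_self _ _⟩
  · obtain ⟨hM, he⟩ := Finset.mem_filter.1 hM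
    have hvol : Λ \ covered Λ M = (Λ.erase v).erase u \ covered ((Λ.erase v).erase u) (M.erase s(v, u)) := by
      ext z
      simp only [Finset.mem_sdiff, mem_erase, mem_covered, not_and, not_exists]
      constructor
      · rintro ⟨hz, hM'⟩
        have hzu : z ≠ u := fun h => hM' hz _ he (h ▸ Sym2.mem_mk_right _ _)
        have hzv : z ≠ v := fun h => hM' hz _ he (h ▸ Sym2.mem_mk_left _ _)
        exact ⟨⟨hzu, hzv, hz⟩, fun _ e he' hze => hM' hz e he'.2 hze⟩
      · rintro ⟨⟨hzu, hzv, hz⟩, hM'⟩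
        refine ⟨hz, fun _ e he' hze => ?_⟩
        by_cases hee : e = s(v, u)
        · subst hee
          rcases Sym2.mem_iff.1 hze with rfl | rfl
          · exact hzv rfl
          · exact hzu rfl
        · exact hM' ⟨hzu, hzv, hz⟩ e ⟨hee, he'⟩ hze
    rw [hvol, ← card_erase_add_one he, pow_succ]
    ring

/-- **Vertex recursion of the source-free dressed SAW at `(-2, -1)`** (the dimer terms cancel the
one-edge strands): for `v ∈ Λ`, `Z(Λ; ∅) = Z(Λ∖v; ∅) - x Σ_{u ∼ v} Z(Λ; {v} ∆ {u})`. [folklore] -/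
theorem dimerPF_empty_eq (hH : H ≤ zdGraph 2) (x : ℝ) {Λ : Finset (Site 2)} {v : Site 2} (hv : v ∈ Λ) :
    dimerPF (-2 : ℝ) (-1) x H Λ ∅ = dimerPF (-2 : ℝ) (-1) x H (Λ.erase v) ∅ -
      x * ∑ u ∈ Λ, aind[H, v, u] * dimerPF (-2 : ℝ) (-1) x H Λ ({v} ∆ {u}) := by
  set c : ℝ := -1 * x ^ 2 with hc
  have hC : ∀ M ∈ dimerConfigs H Λ ∅, M ⊆ edgesIn H Λ := fun M hM => (mem_dimerConfigs.1 hM).1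
  -- Part B: the dimer at `v`
  have hB : ∑ M ∈ (dimerConfigs H Λ ∅).filter (fun M => v ∈ covered Λ M),
      c ^ #M * pf[H, x, Λ \ covered Λ M, ∅] =
      c * ∑ u ∈ Λ, aind[H, v, u] * dimerPF (-2 : ℝ) (-1) x H ((Λ.erase v).erase u) ∅ := by
    have h1 : ∑ M ∈ (dimerConfigs H Λ ∅).filter (fun M => v ∈ covered Λ M),
        c ^ #M * pf[H, x, Λ \ covered Λ M, ∅] =
        ∑ M ∈ dimerConfigs H Λ ∅, (deg[M, v] : ℝ) * (c ^ #M * pf[H, x, Λ \ covered Λ M, ∅]) := by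
      rw [sum_filter]
      refine sum_congr rfl fun M hM => ?_
      by_cases hvM : v ∈ covered Λ M
      · obtain ⟨_, e, he, hve⟩ := mem_covered.1 hvM
        have h1 : 1 ≤ deg[M, v] := card_pos.2 ⟨e, Finset.mem_filter.2 ⟨he, hve⟩⟩
        have : deg[M, v] = 1 := le_antisymm ((mem_dimerConfigs.1 hM).2.1 v hv) h1
        rw [if_pos hvM, this]; simp
      · have : deg[M, v] = 0 := deg_eq_zero_iff.2 fun e he hve => hvM (mem_covered.2 ⟨hv, e, he, hve⟩)
        rw [if_neg hvM, this]; simp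
    rw [h1, ← sum_sum_filter_mk_mem hC, mul_sum]
    refine sum_congr rfl fun u hu => ?_
    by_cases hvu : H.Adj v u
    · rw [sum_filter_dimer x hvu hv hu, aind_of_adj hvu]; ring
    · rw [sum_filter_mk_mem_eq_zero hC hvu, aind_of_not_adj hvu]; ring
  -- Part A: `v` not covered by a dimer; the loop-gas recursion inside
  have hA : ∑ M ∈ (dimerConfigs H Λ ∅).filter (fun M => v ∉ covered Λ M),
      c ^ #M * pf[H, x, Λ \ covered Λ M, ∅] =
      dimerPF (-2 : ℝ) (-1) x H (Λ.erase v) ∅ -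
        x * ∑ u ∈ Λ, aind[H, v, u] * dimerPF (-2 : ℝ) (-1) x H Λ ({v} ∆ {u}) +
        x ^ 2 * ∑ u ∈ Λ, aind[H, v, u] * dimerPF (-2 : ℝ) (-1) x H ((Λ.erase v).erase u) ∅ := by
    have inner : ∀ M ∈ (dimerConfigs H Λ ∅).filter (fun M => v ∉ covered Λ M),
        c ^ #M * pf[H, x, Λ \ covered Λ M, ∅] = c ^ #M * pf[H, x, (Λ \ covered Λ M).erase v, ∅] -
          x * ∑ u ∈ Λ \ covered Λ M, c ^ #M * (aind[H, v, u] * pf[H, x, Λ \ covered Λ M, {v} ∆ {u}]) +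
          x ^ 2 * ∑ u ∈ Λ \ covered Λ M,
            c ^ #M * (aind[H, v, u] * pf[H, x, ((Λ \ covered Λ M).erase v).erase u, ∅]) := by
      intro M hM
      have hvM : v ∈ Λ \ covered Λ M := Finset.mem_sdiff.2 ⟨hv, (Finset.mem_filter.1 hM).2⟩
      rw [pfun_empty_eq hH x hvM, ← mul_sum, ← mul_sum]
      ring
    rw [sum_congr rfl inner, sum_add_distrib, sum_sub_distrib, ← mul_sum, ← mul_sum]
    have hex : ∀ (g : Finset (Sym2 (Site 2)) → Site 2 → ℝ),
        ∑ M ∈ (dimerConfigs H Λ ∅).filter (fun M => v ∉ covered Λ M), ∑ u ∈ Λ \ covered Λ M, g M u =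
          ∑ u ∈ Λ, ∑ M ∈ (dimerConfigs H Λ ∅).filter (fun M => v ∉ covered Λ M ∧ u ∉ covered Λ M),
            g M u := by
      intro g
      refine sum_comm' fun M u => ?_
      rw [Finset.mem_filter, Finset.mem_filter, Finset.mem_sdiff]
      tauto
    have hfilt : ∀ u ∈ Λ, H.Adj v u →
        (dimerConfigs H Λ ∅).filter (fun M => v ∉ covered Λ M ∧ u ∉ covered Λ M) =
        dimerConfigs H ((Λ.erase v).erase u) ∅ := by
      intro u hu hvu
      rw [← filter_filter, filter_notMem_covered, Finset.filter_congr (q := fun M => u ∉ covered (Λ.erase v) M)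
        (fun M hM => by rw [covered_eq_of_subset (mem_dimerConfigs.1 hM).1 (erase_subset _ _)]),
        filter_notMem_covered]
    congr 2
    · -- A1
      rw [filter_notMem_covered, dimerPF_anchor_eq]
      exact sum_congr rfl fun M hM => by rw [sdiff_covered_erase hM]
    · -- A2
      rw [hex]
      congr 1
      refine sum_congr rfl fun u hu => ?_
      by_cases hvu : H.Adj v u
      · rw [hfilt u hu hvu, dimerPF_anchor_eq, dimerConfigs_eq_sdiff Λ, sdiff_symmDiff_eq hvu.ne, mul_sum]
        refine sum_congr rfl fun M _ => ?_
        ring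
      · simp [aind_of_not_adj hvu]
    · -- A3
      rw [hex]
      refine sum_congr rfl fun u hu => ?_
      by_cases hvu : H.Adj v u
      · rw [hfilt u hu hvu, dimerPF_anchor_eq, mul_sum]
        refine sum_congr rfl fun M hM => ?_
        rw [sdiff_erase_comm, sdiff_erase_comm, covered_eq_of_subset (mem_dimerConfigs.1 hM).1
          ((erase_subset _ _).trans (erase_subset _ _))]
        ring
      · simp [aind_of_not_adj hvu]
  rw [dimerPF_anchor_eq, ← hc, ← sum_filter_add_sum_filter_not _ (fun M => v ∈ covered Λ M), hB, hA, hc]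
  ring

end Dimers

/-! ## The induction on the volume -/

section Main

open DiluteLoopModel SimpleGraph Matrix

variable {H : SimpleGraph (Site 2)} [H.LocallyFinite]

/-- No edge has both endpoints in the empty volume. [folklore] -/
theorem edgesIn_empty : edgesIn H (∅ : Finset (Site 2)) = ∅ := by
  ext e
  rw [mem_edgesIn_iff]
  simp only [notMem_empty, iff_false, not_and, not_forall]
  intro _
  induction e using Sym2.ind with
  | _ a b => exact ⟨a, Sym2.mem_mk_left a b, id⟩

/-- On the empty volume the dressed partition function is `1`. [folklore] -/
theorem dimerPF_anchor_vol_empty (hH : H ≤ zdGraph 2) (x : ℝ) : dimerPF (-2 : ℝ) (-1) x H ∅ ∅ = 1 := by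
  have hd : dimerConfigs H (∅ : Finset (Site 2)) ∅ = {∅} := by
    ext M
    rw [mem_dimerConfigs, mem_singleton, edgesIn_empty, subset_empty]
    exact ⟨fun h => h.1, fun h =>
      ⟨h, fun v hv => absurd hv (notMem_empty v), fun v hv => absurd hv (notMem_empty v)⟩⟩
  have hc : cfC[H, (∅ : Finset (Site 2)), ∅] = {∅} := by
    ext F
    rw [mem_cfConfigs_iff hH, mem_singleton, edgesIn_empty, subset_empty]
    exact ⟨fun h => h.1, fun h => ⟨h, empty_subset _, fun z hz => absurd hz (notMem_empty z)⟩⟩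
  rw [dimerPF_anchor_eq, hd, sum_singleton, card_empty, pow_zero, one_mul, sdiff_eq_empty_iff_subset.2
    (empty_subset _), pfun_eq, hc, sum_singleton, card_empty, pow_zero, one_mul, loops_empty, pow_zero]

/-- **`det(1 - xA) = loops(-2) + dimers(-1)`, both identities, by strong induction on the volume.**
[folklore] -/
theorem dimerPF_anchor_eq_adjugate_and_det (hH : H ≤ zdGraph 2) (x : ℝ) :
    ∀ (n : ℕ) (Λ : Finset (Site 2)), #Λ = n →
      (∀ (a b : Site 2) (ha : a ∈ Λ) (hb : b ∈ Λ), a ≠ b →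
        dimerPF (-2 : ℝ) (-1) x H Λ ({a} ∆ {b}) = (K[H, Λ, x]).adjugate ⟨a, ha⟩ ⟨b, hb⟩) ∧
      dimerPF (-2 : ℝ) (-1) x H Λ ∅ = (K[H, Λ, x]).det := by
  intro n
  induction n using Nat.strong_induction_on with
  | _ n ih =>
  intro Λ hn
  have hlt : ∀ {v : Site 2}, v ∈ Λ → #(Λ.erase v) < n := fun hv => by
    rw [card_erase_of_mem hv, hn]
    exact Nat.sub_one_lt (by rw [← hn]; exact card_ne_zero_of_mem hv)
  -- the two-source identity for `Λ`, from both identities on smaller volumes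
  have h2 : ∀ (a b : Site 2) (ha : a ∈ Λ) (hb : b ∈ Λ), a ≠ b →
      dimerPF (-2 : ℝ) (-1) x H Λ ({a} ∆ {b}) = (K[H, Λ, x]).adjugate ⟨a, ha⟩ ⟨b, hb⟩ := by
    intro a b ha hb hab
    obtain ⟨ih1, -⟩ := ih _ (hlt ha) (Λ.erase a) rfl
    have hb' : b ∈ Λ.erase a := mem_erase.2 ⟨hab.symm, hb⟩
    rw [dimerPF_two_eq hH x ha hb hab, adjugate_kmat_symm, adjugate_kmat_eq ha hb hab,
      ← Finset.sum_coe_sort (Λ.erase a)]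
    congr 1
    refine Finset.sum_congr rfl fun u _ => ?_
    congr 1
    by_cases hub : (u : Site 2) = b
    · rw [if_pos hub]
      obtain ⟨-, ih2'⟩ := ih _ ((card_le_card (erase_subset _ _)).trans_lt (hlt ha)) ((Λ.erase a).erase b) rfl
      have hu : u = ⟨b, hb'⟩ := Subtype.ext hub
      rw [ih2', hu, adjugate_kmat_self]
    · rw [if_neg hub, ih1 u b u.2 hb' hub, adjugate_kmat_symm]
  refine ⟨h2, ?_⟩
  -- the source-free identity for `Λ`, from `h2` and the identity on `Λ ∖ v`
  rcases Λ.eq_empty_or_nonempty with rfl | ⟨v, hv⟩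
  · rw [dimerPF_anchor_vol_empty hH, det_eq_one_of_card_eq_zero (by simp)]
  · obtain ⟨-, ih2⟩ := ih _ (hlt hv) (Λ.erase v) rfl
    rw [dimerPF_empty_eq hH x hv, det_kmat_eq hv, ih2, ← Finset.sum_coe_sort Λ]
    congr 2
    refine Finset.sum_congr rfl fun u _ => ?_
    by_cases hvu : H.Adj v u
    · rw [h2 v u hv u.2 hvu.ne, adjugate_kmat_symm]
    · rw [aind_of_not_adj hvu, zero_mul, zero_mul]

end Main

end DetExpansion

/-- **STUB `stub_determinantal` (S2 · Determinantal) of line `symplectic-fermion-anchor`.** On every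
finite piece `(H, Λ)` of `ℤ²`, at loop fugacity `-2` and dimer fugacity `-1` the loop + dimer dressed
self-avoiding walk is a determinant: `Z(H, Λ; {a} ∆ {b}) = adj(1 - xA)_{ab}` and
`Z(H, Λ; ∅) = det(1 - xA)`, `A` the adjacency matrix of `H|_Λ`. Proof: strong induction on `|Λ|`;
the two-source function satisfies the first-step recursion of the adjugate (Laplace expansion of a
cofactor along the deleted vertex, `DetExpansion.adjugate_kmat_eq` / `dimerPF_two_eq`), the
source-free function the Laplace expansion of the determinant along a row (`det_kmat_eq` /
`dimerPF_empty_eq`, where the dimers of fugacity `-1` cancel the one-edge open strands); the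
combinatorial input is the locality/additivity of the closed-strand count `loops` of the tree's
`DiluteLoopModel` over vertex-disjoint unions (`loops_union`) and `loops = 1` on a simple polygon
(`loops_cycle_eq_one`). [cite: Lawler2018, Prop. 3.1 (adjugate / Green's function path expansion)] -/
theorem stub_determinantal :
    ∀ (H : SimpleGraph (Site 2)) [H.LocallyFinite], H ≤ zdGraph 2 →
      ∀ (Λ : Finset (Site 2)) (x : ℝ) (a b : Site 2) (ha : a ∈ Λ) (hb : b ∈ Λ), a ≠ b →
        dimerPF (-2 : ℝ) (-1) x H Λ ({a} ∆ {b}) =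
            ((1 : Matrix Λ Λ ℝ) - x • adjMat H Λ).adjugate ⟨a, ha⟩ ⟨b, hb⟩ ∧
          dimerPF (-2 : ℝ) (-1) x H Λ ∅ = ((1 : Matrix Λ Λ ℝ) - x • adjMat H Λ).det := by
  intro H _ hH Λ x a b ha hb hab
  obtain ⟨h1, h2⟩ := DetExpansion.dimerPF_anchor_eq_adjugate_and_det hH x _ Λ rfl
  exact ⟨h1 a b ha hb hab, h2⟩

end Summit.CriticalPhenomena.SAWScalingLimit.Theorems.AvoidanceLimit.Anchor

end
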